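import Literature.AlgebraicGeometry.Frobenioids.Thm42OfPreStepsGeneralWeak
import Literature.AlgebraicGeometry.Frobenioids.Thm42iiWeak
import Literature.AlgebraicGeometry.Frobenioids.Thm42iiiWeak
import HarnessLib

/-!
# [FrdI] Theorem 4.2 (iii), and (ii)+(iii) together, AS TYPED — Frobenioids NOT of perfect type with WEAKLY
# perf-factorial divisor monoids, MODULO ONLY "`Ψ`, `Ψ⁻¹` preserve pre-steps"; revised (2024) FSMFF corollaries

Mochizuki, *The geometry of Frobenioids I: the general theory*, Kyushu J. Math. **62** (2008) 293–400, §4,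
Theorem 4.2 (ii)(iii), statement pp. 77–78, proof pp. 80–81 (kurims) [cite: MochizukiFrdI2008, Thm. 4.2 (iii) p.78];
*Comments* (2024) (28) p. 3 [cite: MochizukiFrdIComments2024, (28) p.3].

PROOF-ONLY file (cell abc-iut, layer L1, node `FrdI:Thm4.2`; seat abc-iut-L1-t12, row «Thm. 4.2 chain over
`IsPerfFactorialWeak`», L1-lead R129; request of abc-iut-L2-d2).  The last link of the weak-hypothesis twin of
`Thm42OfPreStepsGeneral.lean` (seat abc-iut-w4-d105): with `Objectwise IsPerfFactorial` replaced by
`Objectwise IsPerfFactorialWeak` throughout (Def. 2.4 (i) (a)(b)(c) + (d_ord) + (d_res); printed case via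
`IsPerfFactorial.weak`),
* `FrdI.T42.thm42iii_ofFunctor_of_preservesPreSteps_weak` — the typed `Thm42iii e` for every family `e` with the
  clauses of (ii): Frobenius type / degrees by `FrdI.OfPreSteps` (seat abc-iut-L1-t11), Div-identity endomorphisms by
  Thm. 4.2 (i) through the perfections (`isDivIdentity_map_of_preservesPreSteps_weak`), then `thm42iii_of_weak`;
* `FrdI.T42.thm42ii_iii_ofFunctor_of_preservesPreSteps_weak` — THE family of (ii) exists and (iii) holds for it;
* `…_of_isOfFSMFFType2024_weak` twins over the author's revised (2024) FSMFF bases.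
Together with `thm42i/ii_ofFunctor_of_preservesPreSteps_weak` (`Thm42OfPreStepsGeneralWeak.lean`, `Thm42iiWeak.lean`)
this closes the typed Thm. 4.2 (i)(ii)(iii) over weakly perf-factorial divisor monoids modulo Thm. 3.4 (ii).
No new definitions; no landed declaration touched; nothing of the paper restated or strengthened.  HONEST FRAMING:
classical [FrdI] §4 algebra; nothing here bears on [IUTchIII] Cor. 3.12.
-/

namespace Literature.AlgebraicGeometry.Frobenioids

namespace FrdI.T42

open CategoryTheory Opposite PreFrobenioidData

universe w v v' u u'

variable {D₁ : Type u} [Category.{v} D₁] {Φ₁ : D₁ᵒᵖ ⥤ CommMonCat.{w}} {C₁ : Type u'} [Category.{v'} C₁]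
  {D₂ : Type u} [Category.{v} D₂] {Φ₂ : D₂ᵒᵖ ⥤ CommMonCat.{w}} {C₂ : Type u'} [Category.{v'} C₂]
  {F₁ : C₁ ⥤ ElemFrobenioid Φ₁} {F₂ : C₂ ⥤ ElemFrobenioid Φ₂} (Ψ : C₁ ≌ C₂)

/-- **Theorem 4.2 (iii) AS TYPED (`PreFrobenioidData.Thm42iii`), for Frobenioids with `Φ_i` WEAKLY perf-factorial,
NOT assumed of perfect type, with no base hypothesis beyond print's standard type, MODULO "`Ψ` and `Ψ⁻¹` preserve
pre-steps"**, for every family `e` with the clauses of (ii): the right-hand and left-hand isomorphisms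
`Φ₁(A)_𝔭 ⥲ Φ₂(Ψ A)_{e 𝔭}` at Div-Frobenius-trivial `A` (`thm42iii_of_weak`; Frobenius type / degrees by
`FrdI.OfPreSteps`, Div-identity endomorphisms by Thm. 4.2 (i) through the perfections).  Weak-hypothesis twin of
`thm42iii_ofFunctor_of_preservesPreSteps` (seat abc-iut-w4-d105). [cite: MochizukiFrdI2008, Thm. 4.2 (iii) p.78] -/
theorem thm42iii_ofFunctor_of_preservesPreSteps_weak (hF₁ : PreFrobenioid.IsFrobenioid F₁)
    (hF₂ : PreFrobenioid.IsFrobenioid F₂)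
    (hpf₁ : Objectwise (fun M _ => IsPerfFactorialWeak M) Φ₁)
    (hpf₂ : Objectwise (fun M _ => IsPerfFactorialWeak M) Φ₂)
    (hpre : ∀ ⦃X Y : C₁⦄ (φ : X ⟶ Y), PreFrobenioid.IsPreStep F₁ φ → PreFrobenioid.IsPreStep F₂ (Ψ.functor.map φ))
    (hpre' : ∀ ⦃X Y : C₂⦄ (φ : X ⟶ Y), PreFrobenioid.IsPreStep F₂ φ → PreFrobenioid.IsPreStep F₁ (Ψ.inverse.map φ))
    (e : ∀ A : C₁, Primes (Φ₁.obj (op (PreFrobenioid.baseObj F₁ A))) ≃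
      Primes (Φ₂.obj (op (PreFrobenioid.baseObj F₂ (Ψ.functor.obj A)))))
    (he : ∀ (A : C₁) (𝔭 : Primes (Φ₁.obj (op (PreFrobenioid.baseObj F₁ A)))),
      (∀ ⦃B : C₁⦄ (φ : A ⟶ B), PreFrobenioid.IsCoAngularPreStep F₁ φ →
          (PreFrobenioid.Div F₁ φ ∈ 𝔭.submonoid ↔
            PreFrobenioid.Div F₂ (Ψ.functor.map φ) ∈ (e A 𝔭).submonoid)) ∧
        ∀ ⦃B : C₁⦄ (ψ : B ⟶ A), PreFrobenioid.IsCoAngularPreStep F₁ ψ →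
          ((∃ y ∈ 𝔭.submonoid, Frobenioids.pull Φ₁ (PreFrobenioid.Base F₁ ψ) y = PreFrobenioid.Div F₁ ψ) ↔
            ∃ y ∈ (e A 𝔭).submonoid, Frobenioids.pull Φ₂ (PreFrobenioid.Base F₂ (Ψ.functor.map ψ)) y =
              PreFrobenioid.Div F₂ (Ψ.functor.map ψ))) :
    (ofFunctor Φ₁ F₁).Thm42iii (ofFunctor Φ₂ F₂) Ψ e := by
  intro hT
  obtain ⟨-, -, hnd₁, hnd₂, ⟨N₁, hN₁⟩, ⟨N₂, hN₂⟩⟩ := of_thm42Setting hT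
  have hq₁ := hT.standard.1.quasiIsotropic
  have hq₂ := hT.standard.2.quasiIsotropic
  have hpreI : ∀ ⦃A B : C₁⦄ ⦃φ : A ⟶ B⦄, PreFrobenioid.IsPreStep F₁ φ →
      PreFrobenioid.IsPreStep F₂ (Ψ.functor.map φ) := fun _ _ φ h => hpre φ h
  have hpreI' : ∀ ⦃A B : C₂⦄ ⦃φ : A ⟶ B⦄, PreFrobenioid.IsPreStep F₂ φ →
      PreFrobenioid.IsPreStep F₁ (Ψ.inverse.map φ) := fun _ _ φ h => hpre' φ h
  exact thm42iii_of_weak Ψ hF₁ hF₂ hpf₁ hpf₂ hpre hpre'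
    (fun _ _ _ h => FrdI.OfPreSteps.isFrobeniusType_map_quasiIsotropic hF₁ hF₂ hq₁ hq₂ hnd₁ hnd₂ Ψ hpreI hpreI'
      hN₁ hN₂ h)
    (fun _ _ φ => FrdI.OfPreSteps.degFr_map hF₁ hF₂ hq₁ hq₂ hnd₁ hnd₂ Ψ hpreI hpreI' hN₁ hN₂ φ)
    (fun A α hα => isDivIdentity_map_of_preservesPreSteps_weak Ψ hF₁ hF₂ hpf₁ hpf₂ hpre hpre' hT α hα) e he hT

/-- **Theorem 4.2 (ii) and (iii) together, weakly perf-factorial divisor monoids, not of perfect type, modulo "`Ψ`,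
`Ψ⁻¹` preserve pre-steps"**: THE family of prime bijections of (ii) exists (clauses (a), (b)) and (iii) holds for it.
Weak-hypothesis twin of `thm42ii_iii_ofFunctor_of_preservesPreSteps` (seat abc-iut-w4-d105).
[cite: MochizukiFrdI2008, Thm. 4.2 (iii) p.78] -/
theorem thm42ii_iii_ofFunctor_of_preservesPreSteps_weak (hF₁ : PreFrobenioid.IsFrobenioid F₁)
    (hF₂ : PreFrobenioid.IsFrobenioid F₂)
    (hpf₁ : Objectwise (fun M _ => IsPerfFactorialWeak M) Φ₁)
    (hpf₂ : Objectwise (fun M _ => IsPerfFactorialWeak M) Φ₂)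
    (hpre : ∀ ⦃X Y : C₁⦄ (φ : X ⟶ Y), PreFrobenioid.IsPreStep F₁ φ → PreFrobenioid.IsPreStep F₂ (Ψ.functor.map φ))
    (hpre' : ∀ ⦃X Y : C₂⦄ (φ : X ⟶ Y), PreFrobenioid.IsPreStep F₂ φ → PreFrobenioid.IsPreStep F₁ (Ψ.inverse.map φ))
    (hT : Thm42Setting (ofFunctor Φ₁ F₁) (ofFunctor Φ₂ F₂)) :
    ∃ e : ∀ A : C₁, Primes (Φ₁.obj (op (PreFrobenioid.baseObj F₁ A))) ≃
        Primes (Φ₂.obj (op (PreFrobenioid.baseObj F₂ (Ψ.functor.obj A)))),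
      (∀ (A : C₁) (𝔭 : Primes (Φ₁.obj (op (PreFrobenioid.baseObj F₁ A)))),
        (∀ ⦃B : C₁⦄ (φ : A ⟶ B), PreFrobenioid.IsCoAngularPreStep F₁ φ →
            (PreFrobenioid.Div F₁ φ ∈ 𝔭.submonoid ↔
              PreFrobenioid.Div F₂ (Ψ.functor.map φ) ∈ (e A 𝔭).submonoid)) ∧
          ∀ ⦃B : C₁⦄ (ψ : B ⟶ A), PreFrobenioid.IsCoAngularPreStep F₁ ψ →
            ((∃ y ∈ 𝔭.submonoid, Frobenioids.pull Φ₁ (PreFrobenioid.Base F₁ ψ) y = PreFrobenioid.Div F₁ ψ) ↔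
              ∃ y ∈ (e A 𝔭).submonoid, Frobenioids.pull Φ₂ (PreFrobenioid.Base F₂ (Ψ.functor.map ψ)) y =
                PreFrobenioid.Div F₂ (Ψ.functor.map ψ))) ∧
      (ofFunctor Φ₁ F₁).Thm42iii (ofFunctor Φ₂ F₂) Ψ e := by
  obtain ⟨e, he, -⟩ := thm42ii_ofFunctor_of_preservesPreSteps_weak Ψ hF₁ hF₂ hpf₁ hpf₂ hpre hpre' hT
  have he' : ∀ (A : C₁) (𝔭 : Primes (Φ₁.obj (op (PreFrobenioid.baseObj F₁ A)))),
      (∀ ⦃B : C₁⦄ (φ : A ⟶ B), PreFrobenioid.IsCoAngularPreStep F₁ φ →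
          (PreFrobenioid.Div F₁ φ ∈ 𝔭.submonoid ↔
            PreFrobenioid.Div F₂ (Ψ.functor.map φ) ∈ (e A 𝔭).submonoid)) ∧
        ∀ ⦃B : C₁⦄ (ψ : B ⟶ A), PreFrobenioid.IsCoAngularPreStep F₁ ψ →
          ((∃ y ∈ 𝔭.submonoid, Frobenioids.pull Φ₁ (PreFrobenioid.Base F₁ ψ) y = PreFrobenioid.Div F₁ ψ) ↔
            ∃ y ∈ (e A 𝔭).submonoid, Frobenioids.pull Φ₂ (PreFrobenioid.Base F₂ (Ψ.functor.map ψ)) y =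
              PreFrobenioid.Div F₂ (Ψ.functor.map ψ)) := fun A 𝔭 =>
    ⟨fun B φ hφ => (he A 𝔭).1 φ ((ofFunctor_isCoAngularPreStep F₁ φ).mpr hφ),
      fun B ψ hψ => (he A 𝔭).2 ψ ((ofFunctor_isCoAngularPreStep F₁ ψ).mpr hψ)⟩
  exact ⟨e, he', thm42iii_ofFunctor_of_preservesPreSteps_weak Ψ hF₁ hF₂ hpf₁ hpf₂ hpre hpre' e he'⟩

/-! ### Corollaries over the author's revised (2024) FSMFF bases -/

/-- **Theorem 4.2 (iii) AS TYPED over FSMFF-type bases in the author's revised (2024) sense**, for Frobenioids with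
`Φ_i` WEAKLY perf-factorial, NOT assumed of perfect type, for every family `e` with the clauses of (ii).
[cite: MochizukiFrdI2008, Thm. 4.2 (iii) p.78] [cite: MochizukiFrdIComments2024, (28) p.3] -/
theorem thm42iii_ofFunctor_of_isOfFSMFFType2024_weak (hF₁ : PreFrobenioid.IsFrobenioid F₁)
    (hF₂ : PreFrobenioid.IsFrobenioid F₂)
    (hpf₁ : Objectwise (fun M _ => IsPerfFactorialWeak M) Φ₁)
    (hpf₂ : Objectwise (fun M _ => IsPerfFactorialWeak M) Φ₂)
    (hD₁ : IsOfFSMFFType2024 D₁) (hD₂ : IsOfFSMFFType2024 D₂)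
    (e : ∀ A : C₁, Primes (Φ₁.obj (op (PreFrobenioid.baseObj F₁ A))) ≃
      Primes (Φ₂.obj (op (PreFrobenioid.baseObj F₂ (Ψ.functor.obj A)))))
    (he : ∀ (A : C₁) (𝔭 : Primes (Φ₁.obj (op (PreFrobenioid.baseObj F₁ A)))),
      (∀ ⦃B : C₁⦄ (φ : A ⟶ B), PreFrobenioid.IsCoAngularPreStep F₁ φ →
          (PreFrobenioid.Div F₁ φ ∈ 𝔭.submonoid ↔
            PreFrobenioid.Div F₂ (Ψ.functor.map φ) ∈ (e A 𝔭).submonoid)) ∧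
        ∀ ⦃B : C₁⦄ (ψ : B ⟶ A), PreFrobenioid.IsCoAngularPreStep F₁ ψ →
          ((∃ y ∈ 𝔭.submonoid, Frobenioids.pull Φ₁ (PreFrobenioid.Base F₁ ψ) y = PreFrobenioid.Div F₁ ψ) ↔
            ∃ y ∈ (e A 𝔭).submonoid, Frobenioids.pull Φ₂ (PreFrobenioid.Base F₂ (Ψ.functor.map ψ)) y =
              PreFrobenioid.Div F₂ (Ψ.functor.map ψ))) :
    (ofFunctor Φ₁ F₁).Thm42iii (ofFunctor Φ₂ F₂) Ψ e := fun hT =>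
  thm42iii_ofFunctor_of_preservesPreSteps_weak Ψ hF₁ hF₂ hpf₁ hpf₂
    (fun _ _ _ h => FrdI.isPreStep_map_of_quasiIsotropic_of_isOfFSMFFType2024 hF₁ hF₂
      hT.standard.1.quasiIsotropic hT.standard.2.quasiIsotropic hD₁ hD₂ Ψ h)
    (fun _ _ _ h => FrdI.isPreStep_map_of_quasiIsotropic_of_isOfFSMFFType2024 hF₂ hF₁
      hT.standard.2.quasiIsotropic hT.standard.1.quasiIsotropic hD₂ hD₁ Ψ.symm h) e he hT

/-- **Theorem 4.2 (ii) and (iii) together over FSMFF-type bases in the author's revised (2024) sense**, for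
Frobenioids with `Φ_i` WEAKLY perf-factorial, NOT assumed of perfect type.
[cite: MochizukiFrdI2008, Thm. 4.2 (iii) p.78] [cite: MochizukiFrdIComments2024, (28) p.3] -/
theorem thm42ii_iii_ofFunctor_of_isOfFSMFFType2024_weak (hF₁ : PreFrobenioid.IsFrobenioid F₁)
    (hF₂ : PreFrobenioid.IsFrobenioid F₂)
    (hpf₁ : Objectwise (fun M _ => IsPerfFactorialWeak M) Φ₁)
    (hpf₂ : Objectwise (fun M _ => IsPerfFactorialWeak M) Φ₂)
    (hD₁ : IsOfFSMFFType2024 D₁) (hD₂ : IsOfFSMFFType2024 D₂)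
    (hT : Thm42Setting (ofFunctor Φ₁ F₁) (ofFunctor Φ₂ F₂)) :
    ∃ e : ∀ A : C₁, Primes (Φ₁.obj (op (PreFrobenioid.baseObj F₁ A))) ≃
        Primes (Φ₂.obj (op (PreFrobenioid.baseObj F₂ (Ψ.functor.obj A)))),
      (∀ (A : C₁) (𝔭 : Primes (Φ₁.obj (op (PreFrobenioid.baseObj F₁ A)))),
        (∀ ⦃B : C₁⦄ (φ : A ⟶ B), PreFrobenioid.IsCoAngularPreStep F₁ φ →
            (PreFrobenioid.Div F₁ φ ∈ 𝔭.submonoid ↔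
              PreFrobenioid.Div F₂ (Ψ.functor.map φ) ∈ (e A 𝔭).submonoid)) ∧
          ∀ ⦃B : C₁⦄ (ψ : B ⟶ A), PreFrobenioid.IsCoAngularPreStep F₁ ψ →
            ((∃ y ∈ 𝔭.submonoid, Frobenioids.pull Φ₁ (PreFrobenioid.Base F₁ ψ) y = PreFrobenioid.Div F₁ ψ) ↔
              ∃ y ∈ (e A 𝔭).submonoid, Frobenioids.pull Φ₂ (PreFrobenioid.Base F₂ (Ψ.functor.map ψ)) y =
                PreFrobenioid.Div F₂ (Ψ.functor.map ψ))) ∧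
      (ofFunctor Φ₁ F₁).Thm42iii (ofFunctor Φ₂ F₂) Ψ e :=
  thm42ii_iii_ofFunctor_of_preservesPreSteps_weak Ψ hF₁ hF₂ hpf₁ hpf₂
    (fun _ _ _ h => FrdI.isPreStep_map_of_quasiIsotropic_of_isOfFSMFFType2024 hF₁ hF₂
      hT.standard.1.quasiIsotropic hT.standard.2.quasiIsotropic hD₁ hD₂ Ψ h)
    (fun _ _ _ h => FrdI.isPreStep_map_of_quasiIsotropic_of_isOfFSMFFType2024 hF₂ hF₁
      hT.standard.2.quasiIsotropic hT.standard.1.quasiIsotropic hD₂ hD₁ Ψ.symm h) hT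

end FrdI.T42

end Literature.AlgebraicGeometry.Frobenioids
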